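import Summits.AtomisticToContinuum.Crystallization.Theses.ChessboardParticlePlanes

/-!
# Strategist r1 — typed signatures for the STRATEGY-CENSUS (r1) of crux `PeriodicWindows` (stmt-3240),
# piece `TriangularLayers` (stmt-18045, the W2 wall).

Nothing here is registered as a line (no `stub_`, no `skeleton check`): these are the census's
`## Strengthen` / `## Decomposition` candidates as Lean signatures, with the trivial compositions
kernel-checked, so the census can point at exact statements.

* `LamHull ρ₀ x Z`      — the hypothesis bundle of `TriangularLayers` (rooted rotated-hull point, ρ₀-dense,
                          exactly laminar, 7/10-separated, uniformly recurrent).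
* `SepBootstrap`        — S⁺ (strengthen): laminar hull points are 47/50-separated.
* `SixCoordNarrow δ`    — T1(δ): one spacing `a ∈ [47/50, 1]`; every point has exactly six in-plane
                          points of `Z` within 6/5, all at distance in `[a-δ, a+δ]`.
* `ExactOfSixCoord δ`   — T2(δ): T1(δ)'s conclusion ⟹ `TriangularLayers`' conclusion (exactification).
* `CoarseDensity η R₁`  — T0: coarse in-plane density regularity at scale R₁.
* `triangularLayers_of` — T1(δ) → T2(δ) → TriangularLayers (the bridge composition; trivial by design).
-/

open Literature.MathematicalPhysics.StatisticalMechanics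

namespace Summit.AtomisticToContinuum.Crystallization.Cruxes.PeriodicWindows.StrategistR1

abbrev E3 := EuclideanSpace ℝ (Fin 3)

/-- The hypothesis bundle of `ChessboardParticlePlanes.TriangularLayers` on `(ρ₀, x, Z)`. -/
def LamHull (ρ₀ : ℝ) (x : (N : ℕ) → (Fin N → E3)) (Z : Set E3) : Prop :=
  (0 : E3) ∈ Z ∧
  (∃ (σ : ℕ → ℕ) (τ : ℕ → E3) (A : ℕ → (E3 ≃ₗᵢ[ℝ] E3)), StrictMono σ ∧ ∀ R ε : ℝ, 0 < ε →
      ∀ᶠ j in Filter.atTop, BallMatch ε R 0 (Set.range fun i => A j (x (σ j) i) + τ j) Z) ∧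
  (∀ c : E3, ∃ p ∈ Z, dist p c ≤ ρ₀) ∧
  (∀ p ∈ Z, ∀ q ∈ Z, p 2 ≠ q 2 → (3 : ℝ) / 4 ≤ |p 2 - q 2|) ∧
  (∀ p ∈ Z, ∀ q ∈ Z, p ≠ q → (7 : ℝ) / 10 ≤ dist p q) ∧
  (∀ R ε : ℝ, 0 < ε → ∃ G : ℝ, ∀ w ∈ Z, ∃ g ∈ Z, dist g w ≤ G ∧ BallMatch ε R 0 ((fun p => p - g) '' Z) Z)

/-- The conclusion of `TriangularLayers` at a point `p`: its layer is a translate of a triangular lattice. -/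
def TriangularLayerAt (Z : Set E3) (p : E3) : Prop :=
  ∃ a : ℝ, 0 < a ∧ ∃ u v : E3, u 2 = 0 ∧ v 2 = 0 ∧ ‖u‖ = a ∧ ‖v‖ = a ∧ inner ℝ u v = a ^ 2 / 2 ∧
    {q | q ∈ Z ∧ q 2 = p 2} = {q | ∃ i j : ℤ, q = p + (i : ℝ) • u + (j : ℝ) • v}

/-- **S⁺ (strengthen) — separation bootstrap.** Every laminar hull point is 47/50-separated
(then ring capacities cap the near neighbours at 6 + 3 + 3). Census `## Strengthen` S-r1-a:
no local lever reaches beyond ≈ 0.755 (pair removal) and 47/50 is within 3 % of a* = 0.9713. -/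
def SepBootstrap : Prop :=
  ∀ ρ₀ : ℝ, 0 < ρ₀ → ∀ x : (N : ℕ) → (Fin N → E3), (∀ N, IsGroundState lennardJones (x N)) →
    ∀ Z : Set E3, LamHull ρ₀ x Z → ∀ p ∈ Z, ∀ q ∈ Z, p ≠ q → (47 : ℝ) / 50 ≤ dist p q

/-- **T1(δ) — six-coordination with a δ-narrow annulus, everywhere** (topological + metric local order,
one global spacing). Census `## Decomposition` D-r1-a: this piece remains the whole wall W2. -/
def SixCoordNarrow (δ : ℝ) : Prop :=
  ∀ ρ₀ : ℝ, 0 < ρ₀ → ∀ x : (N : ℕ) → (Fin N → E3), (∀ N, IsGroundState lennardJones (x N)) →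
    ∀ Z : Set E3, LamHull ρ₀ x Z → ∃ a : ℝ, 47 / 50 ≤ a ∧ a ≤ 1 ∧ ∀ p ∈ Z,
      Nat.card {q : E3 // q ∈ Z ∧ q 2 = p 2 ∧ q ≠ p ∧ dist p q ≤ 6 / 5} = 6 ∧
      ∀ q ∈ Z, q 2 = p 2 → q ≠ p → dist p q ≤ 6 / 5 → |dist p q - a| ≤ δ

/-- **T2(δ) — exactification**: six-coordinated-narrow laminar hull points have exactly triangular layers.
Census D-r1-a: tree-doable in kind for small δ (phonon coercivity of relaxed Barlow templates, uniform
in the Hägg word, + recurrence density closing); at large δ it is the open laminar-Liouville regime. -/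
def ExactOfSixCoord (δ : ℝ) : Prop :=
  ∀ ρ₀ : ℝ, 0 < ρ₀ → ∀ x : (N : ℕ) → (Fin N → E3), (∀ N, IsGroundState lennardJones (x N)) →
    ∀ Z : Set E3, LamHull ρ₀ x Z →
      (∃ a : ℝ, 47 / 50 ≤ a ∧ a ≤ 1 ∧ ∀ p ∈ Z,
        Nat.card {q : E3 // q ∈ Z ∧ q 2 = p 2 ∧ q ≠ p ∧ dist p q ≤ 6 / 5} = 6 ∧
        ∀ q ∈ Z, q 2 = p 2 → q ≠ p → dist p q ≤ 6 / 5 → |dist p q - a| ≤ δ) →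
      ∀ p ∈ Z, TriangularLayerAt Z p

/-- **T0(η, R₁) — coarse density regularity**: every in-plane disc of radius `R₁` about a point of `Z`
carries between `(σ - η) π R₁²` and `(σ + η) π R₁²` points of its layer, for one `σ`. Census D-r1-a:
needed to make the r⁻⁶ tail explicit in any localized inequality; no lever beyond NoFoam's ρ₀. -/
def CoarseDensity (η R₁ : ℝ) : Prop :=
  ∀ ρ₀ : ℝ, 0 < ρ₀ → ∀ x : (N : ℕ) → (Fin N → E3), (∀ N, IsGroundState lennardJones (x N)) →
    ∀ Z : Set E3, LamHull ρ₀ x Z → ∃ σ : ℝ, 0 < σ ∧ ∀ p ∈ Z,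
      (σ - η) * (Real.pi * R₁ ^ 2) ≤ Nat.card {q : E3 // q ∈ Z ∧ q 2 = p 2 ∧ dist p q ≤ R₁} ∧
      (Nat.card {q : E3 // q ∈ Z ∧ q 2 = p 2 ∧ dist p q ≤ R₁} : ℝ) ≤ (σ + η) * (Real.pi * R₁ ^ 2)

/-- The bridge composition T1(δ) → T2(δ) → `TriangularLayers` (trivial by design: the seam is modus
ponens; the content is in the two pieces). -/
theorem triangularLayers_of (δ : ℝ) (h1 : SixCoordNarrow δ) (h2 : ExactOfSixCoord δ) :
    Theses.ChessboardParticlePlanes.TriangularLayers := by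
  intro ρ₀ hρ x hx Z h0 hH hD hL hS hR p hp
  have hB : LamHull ρ₀ x Z := ⟨h0, hH, hD, hL, hS, hR⟩
  exact h2 ρ₀ hρ x hx Z hB (h1 ρ₀ hρ x hx Z hB) p hp

/-- Sanity: `TriangularLayerAt` is literally the route's conclusion (definitional). -/
example (Z : Set E3) (p : E3) : TriangularLayerAt Z p ↔
    (∃ a : ℝ, 0 < a ∧ ∃ u v : E3, u 2 = 0 ∧ v 2 = 0 ∧ ‖u‖ = a ∧ ‖v‖ = a ∧ inner ℝ u v = a ^ 2 / 2 ∧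
      {q | q ∈ Z ∧ q 2 = p 2} = {q | ∃ i j : ℤ, q = p + (i : ℝ) • u + (j : ℝ) • v}) := Iff.rfl

end Summit.AtomisticToContinuum.Crystallization.Cruxes.PeriodicWindows.StrategistR1
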